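import Summits.CriticalPhenomena.PercolationContinuityZ3.Theorems.PercNearOneGluingAdditiveGluingBhkTwoAny
import HarnessLib

/-! # Crux `PercNearOneGluing.AdditiveGluing` (stmt-CriticalPhenomena-4576), line `tieline`
(skeleton v12) — stub `stub_crossAnyOneTwo_c7` (BHK Thm. 1.4 cross atom, `S = {s}`, `S' = {x, y}`,
"ANY" form on the `b` side)

Helper file for the crux skeleton of the line `tieline` (lead
prover-line-stmt-CriticalPhenomena-4576-c7-0): proves exactly the registered stub signature
`stub_crossAnyOneTwo_c7`; lands with `--supports stmt-CriticalPhenomena-4576`.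

## Content

Finite weighted graph on `Fin n` (`μ = prodBernoulli w` on `BondConfig (Fin n)`, events
`{u ↔ v} = openConn u v`), three pairwise-relevant vertices `s ≠ x`, `s ≠ y` (one relay `s`, the
other two relays `x, y`), points `o, b`, and the decreasing separation event
`D := {s ↮ x} ∩ {s ↮ y} = (openConn s x)ᶜ ∩ (openConn s y)ᶜ`.  Then

`μ(D) · μ(D ∩ {s ↔ o} ∩ ({x ↔ b} ∪ {y ↔ b})) ≤ μ(D ∩ {s ↔ o}) · μ(D ∩ ({x ↔ b} ∪ {y ↔ b}))`.

This is the literal specialisation `S := {s}`, `S' := {x, y}` of the landed two-set lemma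
`stub_bhkTwoAny_c7` (file `…AdditiveGluingBhkTwoAny`; van den Berg–Häggström–Kahn 2006 Thm. 1.4
for the clusters of two disjoint vertex sets given that they do not meet), after the three set
identities `{ω | ∀ s' ∈ {s}, ∀ x' ∈ {x, y}, s' ↮ x'} = D`, `⋃_{s' ∈ {s}} {s' ↔ o} = {s ↔ o}`,
`⋃_{s' ∈ {x, y}} {s' ↔ b} = {x ↔ b} ∪ {y ↔ b}`.
-/

namespace Summit.CriticalPhenomena.PercolationContinuityZ3.Theorems

open MeasureTheory Set Literature.Probability.LatticeModels Literature.Probability.Percolation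

noncomputable section
open Classical

/-- **BHK 2006 Thm. 1.4, cross atom with one relay against two (`S = {s}`, `S' = {x, y}`, ANY form
on the `b` side):** for `s ≠ x`, `s ≠ y` and `D = {s ↮ x} ∩ {s ↮ y}`,
`μ(D) μ(D ∩ {s ↔ o} ∩ ({x ↔ b} ∪ {y ↔ b})) ≤ μ(D ∩ {s ↔ o}) μ(D ∩ ({x ↔ b} ∪ {y ↔ b}))`
— the specialisation of the landed `stub_bhkTwoAny_c7` to `S := {s}`, `S' := {x, y}`.
[cite: VandenbergHaggstromKahn2005, Thm. 1.4 (p. 7)] -/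
theorem stub_crossAnyOneTwo_c7 : ∀ (n : ℕ) (w : Sym2 (Fin n) → unitInterval) (s x y o b : Fin n), s ≠ x → s ≠ y → (prodBernoulli w).real ((openConn s x)ᶜ ∩ (openConn s y)ᶜ) * (prodBernoulli w).real ((openConn s x)ᶜ ∩ (openConn s y)ᶜ ∩ (openConn s o ∩ (openConn x b ∪ openConn y b))) ≤ (prodBernoulli w).real ((openConn s x)ᶜ ∩ (openConn s y)ᶜ ∩ openConn s o) * (prodBernoulli w).real ((openConn s x)ᶜ ∩ (openConn s y)ᶜ ∩ (openConn x b ∪ openConn y b)) := by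
  intro n w s x y o b hsx hsy
  have hdisj : Disjoint ({s} : Finset (Fin n)) ({x, y} : Finset (Fin n)) := by
    rw [Finset.disjoint_singleton_left]
    simp only [Finset.mem_insert, Finset.mem_singleton, not_or]
    exact ⟨hsx, hsy⟩
  have key := stub_bhkTwoAny_c7 n w {s} {x, y} o b hdisj
  have hD : {ω : BondConfig (Fin n) | ∀ s' ∈ ({s} : Finset (Fin n)), ∀ x' ∈ ({x, y} : Finset (Fin n)),
      ¬ (openGraph ω).Reachable s' x'} = (openConn s x)ᶜ ∩ (openConn s y)ᶜ := by
    ext ω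
    simp only [Finset.mem_insert, Finset.mem_singleton, forall_eq_or_imp, forall_eq,
      Set.mem_setOf_eq, Set.mem_inter_iff, Set.mem_compl_iff, openConn]
  have hO : (⋃ s' ∈ ({s} : Finset (Fin n)), openConn s' o : Set (BondConfig (Fin n))) =
      openConn s o :=
    Finset.set_biUnion_singleton s _
  have hB : (⋃ s' ∈ ({x, y} : Finset (Fin n)), openConn s' b : Set (BondConfig (Fin n))) =
      openConn x b ∪ openConn y b := by
    rw [Finset.set_biUnion_insert, Finset.set_biUnion_singleton]
  rw [hD, hO, hB] at key
  exact key

end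

end Summit.CriticalPhenomena.PercolationContinuityZ3.Theorems
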